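import Literature.Analysis.FluidPDE.PassiveScalarBoundedEnergyEquality
import Literature.Analysis.FluidPDE.PassiveScalarDiagEnergyContinuity
import Literature.Analysis.FluidPDE.PassiveScalarUniquenessL1Sobolev
import HarnessLib

/-!
# Energy identity for BOUNDED passive scalars along `L²` drifts, IV: the `C([0,T]; L²)`
# representative and uniqueness

Analysis/FluidPDE proof file (everything proved; no definitions, no named facts), fourth of the
files discharging `MescoliniPitchoSorella2025_thm24` (Mescolini–Pitcho–Sorella, Ann. Mat. Pura Appl.
204 (2025), Thm. 2.4: "Moreover `ρ^ν` belongs to `C([0,T]; L²(T^d))` up to modification on a zero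
measure set, and for every `t ∈ [0,T]` (2.3)"; "there exists a unique weak solution
`ρ^ν ∈ L^∞((0,T) × T^d) ∩ L²((0,T); H¹(T^d))`"). For a weak solution `θ` of `∂ₜθ + u·∇θ = κΔθ` on
`T^d × [0,T)` (`Torus.IsWeakScalarTransportOn`) which is BOUNDED (`|θ| ≤ M` a.e.), with
`∫₀ᵀ ‖∇θ‖² < ∞`, along a drift `u ∈ L²((0,T) × T^d)`:

* `forall_molInt_eq_of_weaklyContinuous`, `integral_sq_conv_eq_of_forall_molInt_eq` — the mollified
  identities of `PassiveScalarEnergyMollified` hold at EVERY `t ∈ [0,T]` for a weakly `L²`-continuous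
  representative (both sides are continuous in `t` and agree a.e.);
* `energy_eq_of_weaklyContinuous` — hence the energy EQUALITY
  `‖w(t)‖² + 2κ ∫₀ᵗ ‖∇θ‖² = ‖θ₀‖²` at EVERY `t ∈ [0,T]` for the weakly continuous representative `w`
  of `PassiveScalarDiagForcedTrace.exists_weaklyContinuous_representative`
  (`PassiveScalarBoundedEnergyEquality.energy_eq_of_molInt_identity`);
* **`exists_l2Continuous_representative_of_abs_le`** — every solution of the class agrees at a.e.
  time with a weak solution `w` of the same problem which is STRONGLY `L²`-continuous on `[0,T]`
  (`Torus.IsL2ContinuousOn (Icc 0 T) w`, by the Radon–Riesz property of `L²`,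
  `isL2ContinuousOn_of_weaklyContinuous`), has `w(0) = θ₀`, is bounded with the same bound, and
  satisfies the energy equality at every `t ∈ [0,T]` — the `C([0,T];L²)` clause of Thm. 2.4 for
  EVERY solution of the class (Temam 1979, Ch. III §1 Lemma 1.2, here without Lions–Magenes);
* **`ae_eq_of_abs_le`** — UNIQUENESS in the class of Thm. 2.4 for `κ ≥ 0`: two bounded
  `L²_t H¹_x` weak solutions with the same datum along the same `L²` drift agree at a.e. time (the
  difference is in the class with datum `0`, and the energy equality kills it).

## Mathlib / tree search

Tree (reused by name): `exists_weaklyContinuous_representative` (`PassiveScalarDiagForcedTrace`, at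
`a = 1`, `s = 0` through `isWeakScalarTransportDiagForcedOn_one_iff` / `isWeakScalarTransportForcedOn_zero_iff`),
`representative_zero_ae_eq`, `continuousOn_mFourierCoeff_of_weaklyContinuous`
(`PassiveScalarDiagEnergyRepresentative`), `isL2ContinuousOn_of_weaklyContinuous`
(`PassiveScalarDiagEnergyContinuity`), `congr_ae_slice` (`PassiveScalarDiagForcedCongr`),
`ae_forall_molInt_eq_datum_add_setIntegral_flux`, `integrable_mul_flux`, `integrable_molInt_mul_flux`
(`PassiveScalarEnergyMollified`), `sub_of_eq_datum` (`PassiveScalarUniquenessL1Sobolev`),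
`sq_const_add_setIntegral_eq`. Mathlib: `Measure.eqOn_Icc_of_ae_eq`, `intervalIntegral.continuousOn_primitive`.

## References

* G. Mescolini, J. Pitcho, M. Sorella, Ann. Mat. Pura Appl. (4) 204 (2025) 1667–1687, Thm. 2.4,
  proof pp. 1671–1674. [`MescoliniPitchoSorella2025`]
* R. Temam, *Navier–Stokes Equations* (1979), Ch. III §1, Lemma 1.2. [`Temam1979`]
* H. Brezis, *Functional Analysis, Sobolev Spaces and PDE* (2011), Prop. 3.32. [`Brezis2011`]
-/

noncomputable section

open MeasureTheory TopologicalSpace Set Function Filter Metric ContinuousLinearMap UnitAddTorus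
open _root_.Topology
open scoped ENNReal NNReal Convolution ContDiff InnerProductSpace
open Literature.Analysis.FunctionSpaces Literature.Analysis.FunctionSpaces.Torus

namespace Literature.Analysis.FluidPDE

namespace Torus

variable {d : Type*} [Fintype d]

/-! ## Tools -/

section Tools

omit [Fintype d] in
/-- Two functions continuous on `[0,T]` that agree for a.e. `t ∈ (0,T)` agree on `[0,T]`
(`T > 0`). [folklore] -/
private theorem eqOn_Icc_of_ae_Ioo' {Y : Type*} [TopologicalSpace Y] [T2Space Y] {T : ℝ}
    (hT : 0 < T) {f g : ℝ → Y} (hf : ContinuousOn f (Icc 0 T)) (hg : ContinuousOn g (Icc 0 T))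
    (h : ∀ᵐ t ∂(volume.restrict (Ioo 0 T)), f t = g t) : EqOn f g (Icc 0 T) := by
  refine Measure.eqOn_Icc_of_ae_eq (μ := volume) hT.ne ?_ hf hg
  have e : (volume : Measure ℝ).restrict (Icc 0 T) = volume.restrict (Ioo 0 T) :=
    Measure.restrict_congr_set Ioo_ae_eq_Icc.symm
  rw [e]
  exact h

/-- Modifying a `C(S; L²)` field by a.e.-equal slices keeps it in `C(S; L²)`. [folklore] -/
private theorem IsL2ContinuousOn.congr_ae_slice₂ {S : Set ℝ} {θ θ' : ℝ → UnitAddTorus d → ℝ}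
    (h : IsL2ContinuousOn S θ) (hae : ∀ t ∈ S, θ' t =ᵐ[volume] θ t) : IsL2ContinuousOn S θ' := by
  refine ⟨fun t ht => (h.1 t ht).ae_eq (hae t ht).symm, fun t₀ ht₀ => ?_⟩
  refine (h.2 t₀ ht₀).congr' ?_
  filter_upwards [self_mem_nhdsWithin] with t ht
  refine integral_congr_ae ?_
  filter_upwards [hae t ht, hae t₀ ht₀] with x hx hx₀
  simp only [Pi.sub_apply, hx, hx₀]

/-- `‖∇(f - g)‖² ≤ 2(‖∇f‖² + ‖∇g‖²)` for the spectral gradient norm of integrable scalars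
(`𝓕(f - g) = 𝓕f - 𝓕g` termwise and `|a - b|² ≤ 2|a|² + 2|b|²`). [folklore] -/
private theorem eScalarGradNormSq_sub_le {f g : UnitAddTorus d → ℝ} (hf : Integrable f volume)
    (hg : Integrable g volume) :
    eScalarGradNormSq (fun x => f x - g x) ≤ 2 * (eScalarGradNormSq f + eScalarGradNormSq g) := by
  rw [eScalarGradNormSq_eq_tsum, eScalarGradNormSq_eq_tsum, eScalarGradNormSq_eq_tsum]
  have hsub : (fun x => ((f x - g x : ℝ) : ℂ)) = (fun x => (f x : ℂ)) - fun x => (g x : ℂ) := by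
    funext x; simp
  have hterm : ∀ k : d → ℤ, ENNReal.ofReal (FunctionSpaces.Torus.freqNormSq k) *
      ‖mFourierCoeff (fun x => ((f x - g x : ℝ) : ℂ)) k‖ₑ ^ 2 ≤
      2 * (ENNReal.ofReal (FunctionSpaces.Torus.freqNormSq k) * ‖mFourierCoeff (fun x => (f x : ℂ)) k‖ₑ ^ 2 +
        ENNReal.ofReal (FunctionSpaces.Torus.freqNormSq k) * ‖mFourierCoeff (fun x => (g x : ℂ)) k‖ₑ ^ 2) := by
    intro k
    rw [hsub, mFourierCoeff_sub hf.ofReal hg.ofReal, ← mul_add, mul_left_comm]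
    refine mul_le_mul' le_rfl ?_
    calc ‖mFourierCoeff (fun x => (f x : ℂ)) k - mFourierCoeff (fun x => (g x : ℂ)) k‖ₑ ^ 2
        ≤ (‖mFourierCoeff (fun x => (f x : ℂ)) k‖ₑ + ‖mFourierCoeff (fun x => (g x : ℂ)) k‖ₑ) ^ 2 := by
          gcongr
          exact enorm_sub_le
      _ ≤ 2 * ‖mFourierCoeff (fun x => (f x : ℂ)) k‖ₑ ^ 2 + 2 * ‖mFourierCoeff (fun x => (g x : ℂ)) k‖ₑ ^ 2 :=
          FunctionSpaces.Torus.ennreal_add_sq_le _ _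
      _ = 2 * (‖mFourierCoeff (fun x => (f x : ℂ)) k‖ₑ ^ 2 + ‖mFourierCoeff (fun x => (g x : ℂ)) k‖ₑ ^ 2) := by
          ring
  calc ENNReal.ofReal (4 * Real.pi ^ 2) * ∑' k : d → ℤ, ENNReal.ofReal (FunctionSpaces.Torus.freqNormSq k) *
        ‖mFourierCoeff (fun x => ((f x - g x : ℝ) : ℂ)) k‖ₑ ^ 2
      ≤ ENNReal.ofReal (4 * Real.pi ^ 2) * ∑' k : d → ℤ,
          2 * (ENNReal.ofReal (FunctionSpaces.Torus.freqNormSq k) * ‖mFourierCoeff (fun x => (f x : ℂ)) k‖ₑ ^ 2 +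
            ENNReal.ofReal (FunctionSpaces.Torus.freqNormSq k) * ‖mFourierCoeff (fun x => (g x : ℂ)) k‖ₑ ^ 2) :=
        mul_le_mul' le_rfl (ENNReal.tsum_le_tsum hterm)
    _ = _ := by
        rw [ENNReal.tsum_mul_left, ENNReal.tsum_add, mul_add, mul_add]
        ring

end Tools

namespace IsWeakScalarTransportOn

variable {T κ : ℝ} {u : ℝ → UnitAddTorus d → EuclideanSpace ℝ d} {θ₀ : UnitAddTorus d → ℝ}
  {θ : ℝ → UnitAddTorus d → ℝ}

/-- A weak solution of `∂ₜθ + u·∇θ = κΔθ` is a weak solution of the forced diagonal equation with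
all coefficients `1` and source `0` (the bridge to the representative / trace files of the diagonal
layer). [cite: DiPernaLions1989, §II.1 (12)–(14)] -/
theorem isWeakScalarTransportDiagForcedOn_one_zero [DecidableEq d] (h : IsWeakScalarTransportOn T κ u θ₀ θ) :
    IsWeakScalarTransportDiagForcedOn T (fun _ => (1 : ℝ)) κ u 0 θ₀ θ :=
  isWeakScalarTransportDiagForcedOn_one_iff.2 (isWeakScalarTransportForcedOn_zero_iff.2 h)

/-! ## The mollified identities at every time for a weakly continuous representative -/

/-- **The time primitive with datum at EVERY time, for a weakly continuous representative.** If
`w(t) = θ(t)` a.e. for a.e. `t`, `w(t) ∈ L²` and `t ↦ ∫ w(t) g` is continuous on `[0,T]` for every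
`g ∈ L²`, then for every `t ∈ [0,T]`, every smooth kernel `k` and every `x`:
`∫ w(t,y) k(x-y) dy = ∫ θ₀(y) k(x-y) dy + ∫_{(0,t]} G(s, x) ds` (both sides are continuous in `t`
and agree a.e., `ae_forall_molInt_eq_datum_add_setIntegral_flux`). [cite: MescoliniPitchoSorella2025, Thm. 2.4 proof pp. 1671–1674] -/
theorem forall_molInt_eq_of_weaklyContinuous (h : IsWeakScalarTransportOn T κ u θ₀ θ) (hT : 0 < T)
    (hθ₀ : Integrable θ₀ volume) {k : UnitAddTorus d → ℝ} (hk : FunctionSpaces.Torus.IsSmooth k)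
    {w : ℝ → UnitAddTorus d → ℝ}
    (hwae : ∀ᵐ t ∂(volume.restrict (Ioo 0 T)), w t =ᵐ[volume] θ t)
    (hwc : ∀ g : UnitAddTorus d → ℝ, MemLp g 2 volume → ContinuousOn (fun t => ∫ x, w t x * g x) (Icc 0 T)) :
    ∀ t ∈ Icc 0 T, ∀ x : UnitAddTorus d,
      ∫ y, w t y * k (x - y) = (∫ y, θ₀ y * k (x - y)) +
        ∫ s in Ioc 0 t, ∫ y, θ s y *
          (-⟪u s y, FunctionSpaces.Torus.gradient k (x - y)⟫_ℝ + κ * FunctionSpaces.Torus.laplacian k (x - y)) := by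
  intro t ht x
  have hkx : MemLp (fun y => k (x - y)) 2 volume := (hk.comp_sub_left x).memLp 2
  have hf : ContinuousOn (fun t => ∫ y, w t y * k (x - y)) (Icc 0 T) := hwc _ hkx
  have hg : ContinuousOn (fun t => (∫ y, θ₀ y * k (x - y)) +
      ∫ s in Ioc 0 t, ∫ y, θ s y *
        (-⟪u s y, FunctionSpaces.Torus.gradient k (x - y)⟫_ℝ + κ * FunctionSpaces.Torus.laplacian k (x - y))) (Icc 0 T) := by
    have hGx : IntegrableOn (fun t => ∫ y, θ t y *
        (-⟪u t y, FunctionSpaces.Torus.gradient k (x - y)⟫_ℝ + κ * FunctionSpaces.Torus.laplacian k (x - y)))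
        (Ioo 0 T) volume := (h.integrable_mul_flux hk x).integral_prod_left
    exact continuousOn_const.add (intervalIntegral.continuousOn_primitive (hGx.congr_set_ae Ioo_ae_eq_Icc.symm))
  refine eqOn_Icc_of_ae_Ioo' hT hf hg ?_ ht
  filter_upwards [h.ae_forall_molInt_eq_datum_add_setIntegral_flux hθ₀ hk, hwae] with s hs hws
  rw [← hs x]
  exact integral_congr_ae (hws.mono fun y hy => by simp only [hy])

/-- **The mollified energy identity with datum at a GIVEN time.** If an integrable slice `δ` satisfies
the time-primitive identity `∫ δ(y) k(x-y) dy = ∫ θ₀(y) k(x-y) dy + ∫_{(0,t]} G(s,x) ds` for every `x`,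
at some `t ∈ [0,T]`, then `∫ (δ ⋆ k)² = ∫ (θ₀ ⋆ k)² + 2 ∫_{(0,t]} ∫ (θ(s) ⋆ k) G(s)` (chain rule for the
square of a primitive and Fubini — the computation of `ae_integral_sq_molInt_eq` at a fixed time).
[cite: BonicattoCiampaCrippa2023, Thm. 3.3 proof (3.1)] -/
theorem integral_sq_conv_eq_of_forall_molInt_eq (h : IsWeakScalarTransportOn T κ u θ₀ θ)
    (hθ₀ : Integrable θ₀ volume) {k : UnitAddTorus d → ℝ} (hk : FunctionSpaces.Torus.IsSmooth k)
    {t : ℝ} (ht : t ∈ Icc 0 T) {δ : UnitAddTorus d → ℝ}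
    (hAt : ∀ x : UnitAddTorus d, ∫ y, δ y * k (x - y) = (∫ y, θ₀ y * k (x - y)) +
      ∫ s in Ioc 0 t, ∫ y, θ s y *
        (-⟪u s y, FunctionSpaces.Torus.gradient k (x - y)⟫_ℝ + κ * FunctionSpaces.Torus.laplacian k (x - y))) :
    ∫ x, (δ ⋆ k) x ^ 2 = (∫ x, (θ₀ ⋆ k) x ^ 2) +
      2 * ∫ s in Ioc 0 t, ∫ x, ((θ s) ⋆ k) x *
        ∫ y, θ s y * (-⟪u s y, FunctionSpaces.Torus.gradient k (x - y)⟫_ℝ + κ * FunctionSpaces.Torus.laplacian k (x - y)) := by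
  have hsub : Ioo 0 t ⊆ Ioo 0 T := Ioo_subset_Ioo_right ht.2
  have hμ : (volume : Measure ℝ).restrict (Ioc 0 t) = volume.restrict (Ioo 0 t) :=
    Measure.restrict_congr_set Ioo_ae_eq_Ioc.symm
  have hle : (volume : Measure ℝ).restrict (Ioc 0 t) ≤ (volume : Measure ℝ).restrict (Ioo 0 T) := by
    rw [hμ]; exact Measure.restrict_mono_set _ hsub
  have hconv : ∀ (δ : UnitAddTorus d → ℝ) (x : UnitAddTorus d), (δ ⋆ k) x = ∫ y, δ y * k (x - y) :=
    fun δ x => by simp only [convolution_lsmul, smul_eq_mul]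
  simp_rw [hconv]
  -- Step 1: pointwise in `x`
  have hpt : ∀ x, (∫ y, δ y * k (x - y)) ^ 2 = (∫ y, θ₀ y * k (x - y)) ^ 2 +
      2 * ∫ s in Ioc 0 t, (∫ y, θ s y * k (x - y)) *
        ∫ y, θ s y * (-⟪u s y, FunctionSpaces.Torus.gradient k (x - y)⟫_ℝ + κ * FunctionSpaces.Torus.laplacian k (x - y)) := by
    intro x
    have hGx : IntegrableOn (fun s => ∫ y, θ s y *
        (-⟪u s y, FunctionSpaces.Torus.gradient k (x - y)⟫_ℝ + κ * FunctionSpaces.Torus.laplacian k (x - y))) (Ioc 0 t) volume :=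
      ((h.integrable_mul_flux hk x).integral_prod_left).mono_measure hle
    rw [hAt x, sq_const_add_setIntegral_eq hGx]
    congr 2
    refine integral_congr_ae ?_
    have hae : ∀ᵐ s ∂((volume : Measure ℝ).restrict (Ioc 0 t)), ∫ y, θ s y * k (x - y) =
        (∫ y, θ₀ y * k (x - y)) + ∫ τ in Ioc 0 s, ∫ y, θ τ y *
          (-⟪u τ y, FunctionSpaces.Torus.gradient k (x - y)⟫_ℝ + κ * FunctionSpaces.Torus.laplacian k (x - y)) := by
      rw [hμ]
      exact ae_restrict_of_ae_restrict_of_subset hsub (h.ae_molInt_eq_datum_add_setIntegral_flux hk x)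
    filter_upwards [hae] with s hs
    rw [hs, mul_comm]
  -- Step 2: integrate in `x` and swap
  have hA0c : Continuous fun x => ∫ y, θ₀ y * k (x - y) := by
    have e : (fun x => ∫ y, θ₀ y * k (x - y)) = θ₀ ⋆ k := funext fun x => (hconv θ₀ x).symm
    rw [e]
    exact FunctionSpaces.Torus.continuous_convolution hθ₀ hk.continuous
  have i0 : Integrable (fun x => (∫ y, θ₀ y * k (x - y)) ^ 2) volume := (hA0c.pow 2).integrable_unitAddTorus
  have hFi := (h.integrable_molInt_mul_flux hk).mono_measure (Measure.prod_mono hle le_rfl)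
  have hI : Integrable (fun x => ∫ s in Ioc 0 t, (∫ y, θ s y * k (x - y)) *
      ∫ y, θ s y * (-⟪u s y, FunctionSpaces.Torus.gradient k (x - y)⟫_ℝ + κ * FunctionSpaces.Torus.laplacian k (x - y))) volume :=
    hFi.swap.integral_prod_left
  simp_rw [hpt]
  rw [integral_add i0 (hI.const_mul 2), MeasureTheory.integral_const_mul]
  congr 2
  exact integral_integral_swap (μ := (volume : Measure (UnitAddTorus d)))
    (ν := (volume : Measure ℝ).restrict (Ioc 0 t))
    (f := fun x s => (∫ y, θ s y * k (x - y)) *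
      ∫ y, θ s y * (-⟪u s y, FunctionSpaces.Torus.gradient k (x - y)⟫_ℝ + κ * FunctionSpaces.Torus.laplacian k (x - y))) hFi.swap

/-! ## The energy equality at every time and the `C([0,T];L²)` representative -/

/-- **Energy equality at EVERY time for a weakly continuous representative.** Let `θ` be a weak
solution on `T^d × [0,T)`, `T > 0`, with datum `θ₀ ∈ L²`, bounded (`|θ| ≤ M` a.e.), with
`∫₀ᵀ ‖∇θ‖² < ∞`, along a drift `u ∈ L²((0,T) × T^d)`; let `w` agree with `θ` at a.e. time, have `L²`
slices on `[0,T]`, and be weakly `L²`-continuous on `[0,T]`. Then for EVERY `t ∈ [0,T]`,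
`‖w(t)‖²_{L²} + 2κ ∫₀ᵗ ‖∇θ‖²_{L²} = ‖θ₀‖²_{L²}` (the mollified identities hold at every time by
continuity, then `energy_eq_of_molInt_identity`; at `t = 0`, `w(0) = θ₀` a.e.). [cite: MescoliniPitchoSorella2025, Thm. 2.4 (2.3)] -/
theorem energy_eq_of_weaklyContinuous [DecidableEq d] (h : IsWeakScalarTransportOn T κ u θ₀ θ) (hT : 0 < T)
    (hθ₀ : MemLp θ₀ 2 volume)
    {M : ℝ} (hθb : ∀ᵐ t ∂(volume.restrict (Ioo 0 T)), ∀ᵐ x ∂(volume : Measure (UnitAddTorus d)), |θ t x| ≤ M)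
    (hu2 : ∫⁻ t in Ioo 0 T, ∫⁻ x, ‖u t x‖ₑ ^ 2 < ⊤)
    (hD : ∫⁻ t in Ioo 0 T, eScalarGradNormSq (θ t) < ⊤)
    {w : ℝ → UnitAddTorus d → ℝ} (hw2 : ∀ t ∈ Icc 0 T, MemLp (w t) 2 volume)
    (hwae : ∀ᵐ t ∂(volume.restrict (Ioo 0 T)), w t =ᵐ[volume] θ t)
    (hwc : ∀ g : UnitAddTorus d → ℝ, MemLp g 2 volume → ContinuousOn (fun t => ∫ x, w t x * g x) (Icc 0 T)) :
    ∀ t ∈ Icc 0 T,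
      (∫ x, w t x ^ 2) + 2 * κ * (∫⁻ s in Ioo 0 t, eScalarGradNormSq (θ s)).toReal = ∫ x, θ₀ x ^ 2 := by
  intro t ht
  have hθ₀i : Integrable θ₀ volume := hθ₀.integrable one_le_two
  rcases eq_or_lt_of_le ht.1 with h0 | h0
  · -- `t = 0`: `w 0 = θ₀` a.e.
    subst h0
    have hcoef := continuousOn_mFourierCoeff_of_weaklyContinuous hw2 hwc
    have hw0 : w 0 =ᵐ[volume] θ₀ :=
      h.isWeakScalarTransportDiagForcedOn_one_zero.representative_zero_ae_eq hT hθ₀ (hw2 0 ht) hwae hcoef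
    rw [Ioo_self, Measure.restrict_empty, lintegral_zero_measure, ENNReal.toReal_zero, mul_zero, add_zero]
    exact integral_congr_ae (hw0.mono fun x hx => by simp only [hx])
  · obtain ⟨hε, hε', -⟩ := molRadius_spec
    have hkS : ∀ n : ℕ, FunctionSpaces.Torus.IsSmooth (FunctionSpaces.Torus.kernel (d := d) (1 / (4 * ((n : ℝ) + 1)))) :=
      fun n => FunctionSpaces.Torus.isSmooth_kernel (hε n) (hε' n)
    refine h.energy_eq_of_molInt_identity hθ₀ hθb hu2 hD ⟨h0, ht.2⟩ (hw2 t ht) fun n => ?_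
    exact h.integral_sq_conv_eq_of_forall_molInt_eq hθ₀i (hkS n) ht
      (h.forall_molInt_eq_of_weaklyContinuous hT hθ₀i (hkS n) hwae hwc t ht)

/-- The dissipation `t ↦ (∫⁻_{(0,t)} ‖∇θ‖²).toReal` is continuous on `[0,T]` when
`∫₀ᵀ ‖∇θ‖² < ∞`. [folklore] -/
private theorem continuousOn_toReal_lintegral_eScalarGradNormSq (h : IsWeakScalarTransportOn T κ u θ₀ θ)
    (hD : ∫⁻ t in Ioo 0 T, eScalarGradNormSq (θ t) < ⊤) :
    ContinuousOn (fun t => (∫⁻ s in Ioo 0 t, eScalarGradNormSq (θ s)).toReal) (Icc 0 T) := by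
  have hGi : IntegrableOn (fun s => (eScalarGradNormSq (θ s)).toReal) (Ioo 0 T) volume :=
    integrable_toReal_of_lintegral_ne_top h.aemeasurable_eScalarGradNormSq hD.ne
  have hDae : ∀ᵐ s ∂(volume.restrict (Ioo 0 T)), eScalarGradNormSq (θ s) < ⊤ :=
    ae_lt_top' h.aemeasurable_eScalarGradNormSq hD.ne
  have hc : ContinuousOn (fun t => ∫ s in Ioc 0 t, (eScalarGradNormSq (θ s)).toReal) (Icc 0 T) :=
    intervalIntegral.continuousOn_primitive (hGi.congr_set_ae Ioo_ae_eq_Icc.symm)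
  refine hc.congr fun t ht => ?_
  have hsub : Ioo 0 t ⊆ Ioo 0 T := Ioo_subset_Ioo_right ht.2
  show (∫⁻ s in Ioo 0 t, eScalarGradNormSq (θ s)).toReal = ∫ s in Ioc 0 t, (eScalarGradNormSq (θ s)).toReal
  rw [integral_Ioc_eq_integral_Ioo, integral_toReal
    (h.aemeasurable_eScalarGradNormSq.mono_measure (Measure.restrict_mono_set _ hsub))
    (ae_restrict_of_ae_restrict_of_subset hsub hDae)]

/-- **Every bounded `L²_t H¹_x` weak passive scalar along an `L²` drift is a `C([0,T]; L²)` solution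
after modification on a null set of times** (the continuity clause of Mescolini–Pitcho–Sorella 2025,
Thm. 2.4, here for EVERY solution of the class, not only the constructed one). For `T > 0`,
`θ₀ ∈ L²`, a drift `u ∈ L²((0,T) × T^d)` (weakly divergence free at a.e. time) and a weak solution
`θ` with `|θ| ≤ M` a.e. and `∫₀ᵀ ‖∇θ‖² < ∞`, there is a weak solution `w` of the same problem with
`w(t) = θ(t)` a.e. for a.e. `t`, `w(0) = θ₀`, `|w| ≤ M` a.e., STRONGLY `L²`-continuous on `[0,T]`, and
with `‖w(t)‖² + 2κ ∫₀ᵗ ‖∇w‖² = ‖θ₀‖²` at EVERY `t ∈ [0,T]`: the weakly continuous representative has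
the energy equality at every time (`energy_eq_of_weaklyContinuous`), so its energy is continuous,
and Radon–Riesz (`isL2ContinuousOn_of_weaklyContinuous`) gives strong continuity.
[cite: MescoliniPitchoSorella2025, Thm. 2.4 p. 1671] -/
theorem exists_l2Continuous_representative_of_abs_le [Nonempty d] [DecidableEq d] (h : IsWeakScalarTransportOn T κ u θ₀ θ)
    (hT : 0 < T) (hθ₀ : MemLp θ₀ 2 volume)
    {M : ℝ} (hθb : ∀ᵐ t ∂(volume.restrict (Ioo 0 T)), ∀ᵐ x ∂(volume : Measure (UnitAddTorus d)), |θ t x| ≤ M)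
    (hu2 : ∫⁻ t in Ioo 0 T, ∫⁻ x, ‖u t x‖ₑ ^ 2 < ⊤)
    (hD : ∫⁻ t in Ioo 0 T, eScalarGradNormSq (θ t) < ⊤) :
    ∃ w : ℝ → UnitAddTorus d → ℝ,
      IsWeakScalarTransportOn T κ u θ₀ w ∧ IsL2ContinuousOn (Icc 0 T) w ∧ w 0 = θ₀ ∧
      (∀ᵐ t ∂(volume.restrict (Ioo 0 T)), w t =ᵐ[volume] θ t) ∧
      (∀ᵐ t ∂(volume.restrict (Ioo 0 T)), ∀ᵐ x ∂(volume : Measure (UnitAddTorus d)), |w t x| ≤ M) ∧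
      (∫⁻ t in Ioo 0 T, eScalarGradNormSq (w t)) = (∫⁻ t in Ioo 0 T, eScalarGradNormSq (θ t)) ∧
      ∀ t ∈ Icc 0 T,
        (∫ x, w t x ^ 2) + 2 * κ * (∫⁻ s in Ioo 0 t, eScalarGradNormSq (w s)).toReal = ∫ x, θ₀ x ^ 2 := by
  have hdf := h.isWeakScalarTransportDiagForcedOn_one_zero
  obtain ⟨v, hvm, hv2, -, hvae, hvc, -⟩ := hdf.exists_weaklyContinuous_representative hT
  have hv2' : ∀ t ∈ Icc 0 T, MemLp (v t) 2 volume := fun t ht => hv2 t ht.1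
  have hEv := h.energy_eq_of_weaklyContinuous hT hθ₀ hθb hu2 hD hv2' hvae hvc
  -- continuity of the energy, hence strong continuity
  have hR := h.continuousOn_toReal_lintegral_eScalarGradNormSq hD
  have hE : ContinuousOn (fun t => ∫ x, v t x ^ 2) (Icc 0 T) := by
    have hc : ContinuousOn (fun t => (∫ x, θ₀ x ^ 2) -
        2 * κ * (∫⁻ s in Ioo 0 t, eScalarGradNormSq (θ s)).toReal) (Icc 0 T) :=
      continuousOn_const.sub (continuousOn_const.mul hR)
    refine hc.congr fun t ht => ?_
    have e := hEv t ht
    show ∫ x, v t x ^ 2 = (∫ x, θ₀ x ^ 2) - 2 * κ * (∫⁻ s in Ioo 0 t, eScalarGradNormSq (θ s)).toReal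
    linarith
  have hvL2 : IsL2ContinuousOn (Icc 0 T) v := isL2ContinuousOn_of_weaklyContinuous hv2' hvc hE
  have hv0 : v 0 =ᵐ[volume] θ₀ :=
    hdf.representative_zero_ae_eq hT hθ₀ (hv2 0 le_rfl) hvae (continuousOn_mFourierCoeff_of_weaklyContinuous hv2' hvc)
  -- the modified field
  set w : ℝ → UnitAddTorus d → ℝ := Function.update v 0 θ₀ with hw
  have hw_of_ne : ∀ {t : ℝ}, t ≠ 0 → w t = v t := fun ht => by rw [hw, Function.update_of_ne ht]
  have hw0 : w 0 = θ₀ := by rw [hw, Function.update_self]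
  have hwv : ∀ t ∈ Icc 0 T, w t =ᵐ[volume] v t := by
    intro t ht
    rcases eq_or_ne t 0 with rfl | hne
    · rw [hw0]; exact hv0.symm
    · rw [hw_of_ne hne]
  have hwae : ∀ᵐ t ∂(volume.restrict (Ioo 0 T)), w t =ᵐ[volume] θ t := by
    filter_upwards [hvae, ae_restrict_mem measurableSet_Ioo] with t ht htI
    rw [hw_of_ne htI.1.ne']
    exact ht
  have hwm : AEStronglyMeasurable (stLift w) (volume.restrict (Ioo 0 T ×ˢ univ)) := by
    refine (hvm.mono_measure (Measure.restrict_mono (Set.prod_mono Ioo_subset_Ioi_self le_rfl) le_rfl)).congr ?_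
    filter_upwards [ae_restrict_mem (measurableSet_Ioo.prod MeasurableSet.univ)] with p hp
    obtain ⟨t, y⟩ := p
    simp only [FunctionSpaces.Torus.stLift_apply, hw_of_ne (mem_prod.1 hp).1.1.ne']
  have hwsol : IsWeakScalarTransportOn T κ u θ₀ w :=
    isWeakScalarTransportForcedOn_zero_iff.1 (isWeakScalarTransportDiagForcedOn_one_iff.1 (hdf.congr_ae_slice hwm hwae))
  have hwL2 : IsL2ContinuousOn (Icc 0 T) w := hvL2.congr_ae_slice₂ hwv
  -- the gradient and the bound transfer along a.e. equality of slices
  have hgrad : ∀ᵐ t ∂(volume.restrict (Ioo 0 T)), eScalarGradNormSq (w t) = eScalarGradNormSq (θ t) := by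
    filter_upwards [hwae] with t ht
    rw [eScalarGradNormSq_eq_tsum, eScalarGradNormSq_eq_tsum]
    congr 1
    refine tsum_congr fun k => ?_
    have hc : (fun x => (w t x : ℂ)) =ᵐ[volume] fun x => (θ t x : ℂ) := ht.mono fun x hx => by simp only [hx]
    rw [FunctionSpaces.Torus.mFourierCoeff_congr_ae hc]
  have hDw : (∫⁻ t in Ioo 0 T, eScalarGradNormSq (w t)) = ∫⁻ t in Ioo 0 T, eScalarGradNormSq (θ t) :=
    lintegral_congr_ae hgrad
  have hwb : ∀ᵐ t ∂(volume.restrict (Ioo 0 T)), ∀ᵐ x ∂(volume : Measure (UnitAddTorus d)), |w t x| ≤ M := by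
    filter_upwards [hwae, hθb] with t ht hb
    filter_upwards [ht, hb] with x hx hbx
    rw [hx]; exact hbx
  refine ⟨w, hwsol, hwL2, hw0, hwae, hwb, hDw, fun t ht => ?_⟩
  have hsub : Ioo 0 t ⊆ Ioo 0 T := Ioo_subset_Ioo_right ht.2
  have e1 : (∫⁻ s in Ioo 0 t, eScalarGradNormSq (w s)) = ∫⁻ s in Ioo 0 t, eScalarGradNormSq (θ s) :=
    lintegral_congr_ae (ae_restrict_of_ae_restrict_of_subset hsub hgrad)
  have e2 : ∫ x, w t x ^ 2 = ∫ x, v t x ^ 2 :=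
    integral_congr_ae ((hwv t ht).mono fun x hx => by simp only [hx])
  rw [e1, e2]
  exact hEv t ht

/-! ## Uniqueness in the class of Thm. 2.4 -/

/-- **Uniqueness of bounded `L²_t H¹_x` weak passive scalars along `L²` drifts** (the uniqueness
clause of Mescolini–Pitcho–Sorella 2025, Thm. 2.4): for `κ ≥ 0`, two weak solutions of
`∂ₜθ + u·∇θ = κΔθ` on `T^d × [0,T)` with the same datum, along the same drift `u ∈ L²((0,T) × T^d)`,
both bounded a.e. and with `∫₀ᵀ ‖∇θᵢ‖² < ∞`, agree for a.e. `t ∈ (0,T)` — the difference is a weak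
solution of the class with datum `0`, and the energy equality `ae_energy_eq_of_abs_le` gives
`‖θ₁(t) - θ₂(t)‖² + 2κ ∫₀ᵗ ‖∇(θ₁ - θ₂)‖² = 0`. [cite: MescoliniPitchoSorella2025, Thm. 2.4 p. 1671] -/
theorem ae_eq_of_abs_le (hκ : 0 ≤ κ) {θ₁ θ₂ : ℝ → UnitAddTorus d → ℝ}
    (h₁ : IsWeakScalarTransportOn T κ u θ₀ θ₁) (h₂ : IsWeakScalarTransportOn T κ u θ₀ θ₂)
    {M₁ M₂ : ℝ}
    (hb₁ : ∀ᵐ t ∂(volume.restrict (Ioo 0 T)), ∀ᵐ x ∂(volume : Measure (UnitAddTorus d)), |θ₁ t x| ≤ M₁)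
    (hb₂ : ∀ᵐ t ∂(volume.restrict (Ioo 0 T)), ∀ᵐ x ∂(volume : Measure (UnitAddTorus d)), |θ₂ t x| ≤ M₂)
    (hu2 : ∫⁻ t in Ioo 0 T, ∫⁻ x, ‖u t x‖ₑ ^ 2 < ⊤)
    (hD₁ : ∫⁻ t in Ioo 0 T, eScalarGradNormSq (θ₁ t) < ⊤)
    (hD₂ : ∫⁻ t in Ioo 0 T, eScalarGradNormSq (θ₂ t) < ⊤) :
    ∀ᵐ t ∂(volume.restrict (Ioo 0 T)), θ₁ t =ᵐ[volume] θ₂ t := by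
  have hsub := h₁.sub_of_eq_datum h₂
  have hb : ∀ᵐ t ∂(volume.restrict (Ioo 0 T)), ∀ᵐ x ∂(volume : Measure (UnitAddTorus d)),
      |(fun t x => θ₁ t x - θ₂ t x) t x| ≤ M₁ + M₂ := by
    filter_upwards [hb₁, hb₂] with t h1 h2
    filter_upwards [h1, h2] with x hx1 hx2
    exact (abs_sub _ _).trans (add_le_add hx1 hx2)
  have hD : ∫⁻ t in Ioo 0 T, eScalarGradNormSq ((fun t x => θ₁ t x - θ₂ t x) t) < ⊤ := by
    have hle : ∫⁻ t in Ioo 0 T, eScalarGradNormSq ((fun t x => θ₁ t x - θ₂ t x) t) ≤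
        ∫⁻ t in Ioo 0 T, 2 * (eScalarGradNormSq (θ₁ t) + eScalarGradNormSq (θ₂ t)) := by
      refine lintegral_mono_ae ?_
      filter_upwards [h₁.ae_slice_integrable₁, h₂.ae_slice_integrable₁] with t ht1 ht2
      exact eScalarGradNormSq_sub_le ht1.1 ht2.1
    refine hle.trans_lt ?_
    rw [lintegral_const_mul' _ _ (by norm_num), lintegral_add_left' h₁.aemeasurable_eScalarGradNormSq]
    exact ENNReal.mul_lt_top (by norm_num) (ENNReal.add_lt_top.2 ⟨hD₁, hD₂⟩)
  have hE := hsub.ae_energy_eq_of_abs_le (MemLp.zero : MemLp (0 : UnitAddTorus d → ℝ) 2 volume) hb hu2 hD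
  filter_upwards [hE, h₁.ae_memLp_two, h₂.ae_memLp_two] with t ht hm1 hm2
  have hz : ∫ x, (0 : UnitAddTorus d → ℝ) x ^ 2 = 0 := by simp
  rw [hz] at ht
  have hnn : 0 ≤ 2 * κ * (∫⁻ s in Ioo 0 t, eScalarGradNormSq (fun x => θ₁ s x - θ₂ s x)).toReal := by
    positivity
  have hsq : ∫ x, (θ₁ t x - θ₂ t x) ^ 2 = 0 :=
    le_antisymm (by linarith) (integral_nonneg fun x => sq_nonneg _)
  have hint : Integrable (fun x => (θ₁ t x - θ₂ t x) ^ 2) volume := by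
    have := (hm1.sub hm2).integrable_sq
    exact this
  have hae := (integral_eq_zero_iff_of_nonneg (fun x => sq_nonneg _) hint).1 hsq
  filter_upwards [hae] with x hx
  exact sub_eq_zero.1 (pow_eq_zero_iff two_ne_zero |>.1 hx)

end IsWeakScalarTransportOn

end Torus

end Literature.Analysis.FluidPDE
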